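import Literature.NumberTheory.Automorphic.HarrisLanTaylorThorneTwistedPairLimitProofs
import Literature.NumberTheory.Automorphic.ReciprocityGLnExistenceProofs
import Literature.NumberTheory.GaloisRepresentations.GaloisRepOfAlgebraValuedLimit
import Summits.Langlands.Langlands.Theorems.IrreducibilityBySelfDualityGaloisRepGL2CMaeFirstLemma
import HarnessLib

/-!
# `FirstLemmaInduced` for the crux `GaloisRepGL2CMae` (item stmt-Langlands-16722), line `Sketch`

Harris–Lan–Taylor–Thorne 2016, Cor. 6.26–6.27 at `n = 2` (unramified alternative, presented CM
field `K/Fp`), as PROVABLE glue, in the CORRECTED form of the line lead c2 (stub S3'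
`stub_firstLemmaInduced` of the skeleton `Cruxes/GaloisRepGL2CMae/Lines/Sketch.lean`, replacing S3
`stub_firstLemma`, whose first hypothesis — the Literature fact
`HarrisLanTaylorThorne2016_twistedPairLimit_two` — is proved absurd in
`Literature/NumberTheory/Automorphic/HarrisLanTaylorThorneTwistedPairLimitMisstated.lean`).

Inputs (both HYPOTHESES of the signature; no named fact is used):

* (α)₂' — HLTT §6 at `n = 2` read on `Ind(π^∞‖det‖^N)`: at the good places `v` (`v ∣ q`, `q ≠ p`
  unramified in `K`, `π` unramified above `q`) the prescription
  `P_v = arithFrobPolyOfSatake ι q_v 2 (α_v · q_v^{-N}) · ∏_{b ∈ B_v}(X - b q_v^{-N})` — the arithmetic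
  Frobenius polynomial of `R_p(ı⁻¹(π^∞‖det‖^N)) = r ε_p^{N} ⊕ r^{c,∨} ε_p^{-3-N}` (Cor. 6.26 applied to
  `π‖det‖^N`) — is, for every `m`, an algebra-valued `p^{-m}`-limit of base-change Satake polynomials of
  cuspidal automorphic representations of `U_{K/Fp}(4)` with regular discrete series at infinity;
* (β′) — HLTT Cor. 1.3 for such cuspidal representations of `U_{K/Fp}(2n)`.

Output (UNCHANGED from the old first lemma, so that the landed `stub_thm713` applies): for every
`N ≥ N₀` a continuous semisimple `R N : Γ_K → GL₄(ℚ̄_p)`, unramified at the good places with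
`char R N (Frob_v) = arithFrobPolyOfSatake ι q_v 2 α_v · ∏_{b ∈ B_v}(X - b q_v^{-2N})`, i.e. Cor. 6.27's
`R_{p,ı}(π, N) = r ⊕ r^{c,∨} ε_p^{-3-2N}`.

Proof = the printed proof of Cor. 6.27 (Res. Math. Sci. 3:37, p. 225: "Take
`R_{p,ı}(π,N) = R_p(ı⁻¹(π^∞‖det‖^N)) ⊗ ε_p^{-N}`"): the algebra-valued limit theorem
`exists_semisimple_galoisRep_of_algebraValuedLimit` (Taylor 1991 §1) in rank `4` gives
`R'_N = R_p(ı⁻¹(π^∞‖det‖^N))`, and the Tate twist `R_N = R'_N ⊗ ε_p^{-N}`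
(`HarrisLanTaylorThorne2016.exists_tateTwist_semisimple`) multiplies every arithmetic-Frobenius root at
`v ∤ p` by `q_v^{-N}`: `q_v^{-N} · ι⁻¹((√q_v · a q_v^{-N})⁻¹) = ι⁻¹((√q_v a)⁻¹)` and
`q_v^{-N} · b q_v^{-N} = b q_v^{-2N}`.
-/

set_option linter.dupNamespace false

noncomputable section

open scoped MatrixGroups Matrix NumberField Polynomial
open NumberField IsDedekindDomain Field Polynomial Filter
open Literature.NumberTheory.Automorphic Literature.NumberTheory.GaloisRepresentations
open Literature.NumberTheory.Automorphic.HarrisLanTaylorThorne2016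

namespace Summit.Langlands.Langlands.Theorems.GaloisRepGL2CMae

/-- **Root bookkeeping for the Tate twist `⊗ ε_p^{-N}` of the induced pair** (first summand): for
`a ∈ ℂ`, `q ≠ 0` and `s = √q`,
`q^{-N} · ι⁻¹((s · (a q^{-N}))⁻¹) = ι⁻¹((s a)⁻¹)` in `ℚ̄_p` (`ι⁻¹` is multiplicative and fixes `q`).
[folklore] -/
theorem zpow_neg_mul_symm_inv_rescale {p : ℕ} [Fact p.Prime] (ι : PadicAlgCl p ≃+* ℂ) {q : ℕ}
    (hq : q ≠ 0) (s a : ℂ) (N : ℕ) :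
    (q : PadicAlgCl p) ^ (-(N : ℤ)) * ι.symm (s * (a * ((q : ℂ)⁻¹) ^ N))⁻¹ = ι.symm (s * a)⁻¹ := by
  have hqC : (q : ℂ) ≠ 0 := by exact_mod_cast hq
  have hqP : (q : PadicAlgCl p) ≠ 0 := by exact_mod_cast hq
  have h1 : (s * (a * ((q : ℂ)⁻¹) ^ N))⁻¹ = (s * a)⁻¹ * (q : ℂ) ^ N := by
    rw [← mul_assoc, mul_inv, inv_pow, inv_inv]
  rw [h1, map_mul, map_pow, map_natCast, zpow_neg, zpow_natCast]
  rw [mul_comm (ι.symm (s * a)⁻¹) _, ← mul_assoc, inv_mul_cancel₀ (pow_ne_zero _ hqP), one_mul]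

/-- **Root bookkeeping for the Tate twist `⊗ ε_p^{-N}` of the induced pair** (second summand):
`q^{-N} · (b q^{-N}) = b q^{-2N}`. [folklore] -/
theorem zpow_neg_mul_mul_inv_pow {p : ℕ} [Fact p.Prime] {q : ℕ} (b : PadicAlgCl p) (N : ℕ) :
    (q : PadicAlgCl p) ^ (-(N : ℤ)) * (b * ((q : PadicAlgCl p)⁻¹) ^ N) =
      b * ((q : PadicAlgCl p)⁻¹) ^ (2 * N) := by
  rw [zpow_neg, zpow_natCast, ← inv_pow, two_mul, pow_add]
  ring

/-- **First lemma, induced form** (Harris–Lan–Taylor–Thorne 2016, Cor. 6.26–6.27 at `n = 2`,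
unramified alternative, presented CM field): (α)₂' → (β′) → for `N ≥ N₀` a continuous semisimple
`R N : Γ_K → GL₄(ℚ̄_p)`, unramified at the good places `v` (`v ∣ q`, `q ≠ p` unramified in `K`, `π`
unramified above `q`) with
`char R N (Frob_v) = arithFrobPolyOfSatake ι q_v 2 α_v · ∏_{b ∈ B_v}(X - b q_v^{-2N})`.
Proof: the algebra-valued limit theorem in rank `4` gives `R'_N = R_p(ı⁻¹(π^∞‖det‖^N))` with
`char R'_N(Frob_v) = arithFrobPolyOfSatake ι q_v 2 (α_v q_v^{-N}) · ∏_{b ∈ B_v}(X - b q_v^{-N})`, and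
`R_N := R'_N ⊗ ε_p^{-N}` (printed proof of Cor. 6.27).
[cite: HarrisLanTaylorThorneRMS2016, Cor. 6.26–6.27 and the proof of Cor. 6.27 (p. 225)] -/
theorem stub_firstLemmaInduced :
    (∀ (Fp K : Type) [Field Fp] [NumberField Fp] [Field K] [NumberField K] [Algebra Fp K]
      (cK : K ≃ₐ[Fp] K), IsTotallyReal Fp → Module.finrank Fp K = 2 → ∀ (hc : cK ≠ 1),
      IsTotallyComplex K →
      ∀ (hcpt : isCompact_glFiniteIntegralLevel 2 K) (p : ℕ) [Fact p.Prime]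
        (E₀ : IntermediateField ℚ K), Module.finrank ℚ E₀ = 2 ∧ IsTotallyComplex E₀ →
        HasTwoPrimesOver E₀ p →
      ∀ (π : CuspidalAutomorphicRepData 2 K hcpt), π.1.IsRegularAlgebraic →
      ∀ (ι : PadicAlgCl p ≃+* ℂ),
      ∃ (N₀ : ℕ) (B : HeightOneSpectrum (𝓞 K) → Multiset (PadicAlgCl p)),
        (∀ v, Multiset.card (B v) = 2 ∧ (0 : PadicAlgCl p) ∉ B v) ∧
        ∀ N, N₀ ≤ N →
          ∃ (E : IntermediateField ℚ_[p] (PadicAlgCl p)) (S : Set (HeightOneSpectrum (𝓞 K)))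
            (P : HeightOneSpectrum (𝓞 K) → (PadicAlgCl p)[X]),
            FiniteDimensional ℚ_[p] E ∧ S.Finite ∧
            (∀ v, (∃ q : ℕ, q.Prime ∧ q ≠ p ∧ ((q : ℕ) : 𝓞 K) ∈ v.asIdeal ∧
                Algebra.IsUnramifiedIn (𝓞 K) (Ideal.span {(q : ℤ)}) ∧ π.1.IsUnramifiedAbove q) →
              v ∉ S) ∧
            (∀ v ∈ S, ((p : ℕ) : 𝓞 K) ∉ v.asIdeal →
              ∀ v' : HeightOneSpectrum (𝓞 K), v'.asIdeal.under ℤ = v.asIdeal.under ℤ → v' ∈ S) ∧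
            (∀ v, (∃ q : ℕ, q.Prime ∧ q ≠ p ∧ ((q : ℕ) : 𝓞 K) ∈ v.asIdeal ∧
                Algebra.IsUnramifiedIn (𝓞 K) (Ideal.span {(q : ℤ)}) ∧ π.1.IsUnramifiedAbove q) →
              ∀ α : Multiset ℂ, π.1.HasSatakeParamAt v α →
                P v = arithFrobPolyOfSatake ι v.residueCard 2
                    (α.map (· * ((v.residueCard : ℂ)⁻¹) ^ N)) *
                  ((B v).map fun b ↦
                    X - C (b * ((v.residueCard : PadicAlgCl p)⁻¹) ^ N)).prod) ∧
            (∀ v ∉ S, ∀ k : ℕ, (P v).coeff k ∈ E) ∧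
            ∀ m : ℕ, ∃ (r : ℕ) (hcpt4 : isCompact_glFiniteIntegralLevel 4 K)
                (σ' : Fin r → UnitaryGroup.CuspidalAutomorphicRepData Fp K cK 4 hcpt4)
                (Q : Fin r → HeightOneSpectrum (𝓞 K) → (PadicAlgCl p)[X]) (δ : ℝ), 0 < δ ∧
              (∀ i (w : {w : InfinitePlace K // w.IsComplex}) (hw : cK • w.1 = w.1),
                  ∃ (a b : ℕ) (d : LDSDatum a b), d.IsRegular ∧
                    UnitaryGroup.IsNondegenerateLimitOfDiscreteSeriesAt Fp K cK 4
                      (StdForm.antidiagonal 4) hcpt4 (σ' i).1 hw hc d) ∧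
              (∀ i, ∀ v ∉ S, ((p : ℕ) : 𝓞 K) ∉ v.asIdeal →
                  v.asIdeal.ramificationIdx ℤ = 1 ∧
                  (∃ β, UnitaryGroup.HasBaseChangeSatakeAt Fp K cK 4 hcpt4 (σ' i).1 v β) ∧
                  ∀ β, UnitaryGroup.HasBaseChangeSatakeAt Fp K cK 4 hcpt4 (σ' i).1 v β →
                    Q i v = arithFrobPolyOfSatake ι v.residueCard 4 β) ∧
              ∀ F : MvPolynomial (HeightOneSpectrum (𝓞 K) × ℕ) ℤ,
                (∀ vk ∈ F.vars, vk.1 ∉ S ∧ ((p : ℕ) : 𝓞 K) ∉ vk.1.asIdeal) →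
                (∀ i, ‖MvPolynomial.aeval
                    (fun vk : HeightOneSpectrum (𝓞 K) × ℕ => (Q i vk.1).coeff vk.2) F‖ ≤ δ) →
                  ‖MvPolynomial.aeval
                      (fun vk : HeightOneSpectrum (𝓞 K) × ℕ => (P vk.1).coeff vk.2) F‖ ≤
                    (p : ℝ) ^ (-(m : ℤ))) →
    (∀ (Fp K : Type) [Field Fp] [NumberField Fp] [Field K] [NumberField K] [Algebra Fp K]
      (cK : K ≃ₐ[Fp] K), IsTotallyReal Fp → Module.finrank Fp K = 2 → ∀ (hc : cK ≠ 1),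
      IsTotallyComplex K → ∀ (n : ℕ) (p : ℕ) [Fact p.Prime] (ι : PadicAlgCl p ≃+* ℂ)
      (E₀ : IntermediateField ℚ K), Module.finrank ℚ E₀ = 2 ∧ IsTotallyComplex E₀ →
        HasTwoPrimesOver E₀ p →
      ∀ (hcptK : isCompact_glFiniteIntegralLevel (2 * n) K)
      (σ' : UnitaryGroup.CuspidalAutomorphicRepData Fp K cK (2 * n) hcptK),
      (∀ (w : {w : InfinitePlace K // w.IsComplex}) (hw : cK • w.1 = w.1),
        ∃ (a b : ℕ) (d : LDSDatum a b), d.IsRegular ∧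
          UnitaryGroup.IsNondegenerateLimitOfDiscreteSeriesAt Fp K cK (2 * n)
            (StdForm.antidiagonal (2 * n)) hcptK σ'.1 hw hc d) →
      ∃ r : FramedGaloisRep K (PadicAlgCl p) (2 * n), r.toGaloisRep.IsSemisimple ∧
        ∀ (u : HeightOneSpectrum (𝓞 K)) (β : Multiset ℂ), ((p : ℕ) : 𝓞 K) ∉ u.asIdeal →
          (∀ u' : HeightOneSpectrum (𝓞 K), u'.asIdeal.under ℤ = u.asIdeal.under ℤ →
            u'.asIdeal.ramificationIdx ℤ = 1 ∧
              UnitaryGroup.IsUnramifiedAt Fp K cK (2 * n) hcptK σ'.1 u') →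
          UnitaryGroup.HasBaseChangeSatakeAt Fp K cK (2 * n) hcptK σ'.1 u β →
            r.IsUnramifiedAt u ∧
              r.HasFrobCharpolyAt u (arithFrobPolyOfSatake ι u.residueCard (2 * n) β)) →
    ∀ (Fp K : Type) [Field Fp] [NumberField Fp] [Field K] [NumberField K] [Algebra Fp K]
      (cK : K ≃ₐ[Fp] K), IsTotallyReal Fp → Module.finrank Fp K = 2 → cK ≠ 1 →
      IsTotallyComplex K →
      ∀ (hcpt : isCompact_glFiniteIntegralLevel 2 K) (p : ℕ) [Fact p.Prime]
        (E₀ : IntermediateField ℚ K), Module.finrank ℚ E₀ = 2 ∧ IsTotallyComplex E₀ →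
        HasTwoPrimesOver E₀ p →
      ∀ (π : CuspidalAutomorphicRepData 2 K hcpt), π.1.IsRegularAlgebraic →
      ∀ (ι : PadicAlgCl p ≃+* ℂ),
      ∃ (N₀ : ℕ) (R : ℕ → FramedGaloisRep K (PadicAlgCl p) 4)
        (B : HeightOneSpectrum (𝓞 K) → Multiset (PadicAlgCl p)),
        (∀ N, N₀ ≤ N → (R N).toGaloisRep.IsSemisimple) ∧
        (∀ v, Multiset.card (B v) = 2 ∧ (0 : PadicAlgCl p) ∉ B v) ∧
        ∀ v, (∃ q : ℕ, q.Prime ∧ q ≠ p ∧ ((q : ℕ) : 𝓞 K) ∈ v.asIdeal ∧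
            Algebra.IsUnramifiedIn (𝓞 K) (Ideal.span {(q : ℤ)}) ∧ π.1.IsUnramifiedAbove q) →
          ∀ α : Multiset ℂ, π.1.HasSatakeParamAt v α →
          ∀ N, N₀ ≤ N → (R N).IsUnramifiedAt v ∧
            (R N).HasFrobCharpolyAt v (arithFrobPolyOfSatake ι v.residueCard 2 α *
              ((B v).map fun b ↦
                X - C (b * ((v.residueCard : PadicAlgCl p)⁻¹) ^ (2 * N))).prod) := by
  intro hα hβ Fp K _ _ _ _ _ cK hFp h2 hc hK hcpt p _ E₀ hE₀ hsplit π hπ ι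
  obtain ⟨N₀, B, hB, hN⟩ := hα Fp K cK hFp h2 hc hK hcpt p E₀ hE₀ hsplit π hπ ι
  -- Cor. 6.27 at `n = 2` for each `N ≥ N₀`
  have key : ∀ N, N₀ ≤ N → ∃ ρ : FramedGaloisRep K (PadicAlgCl p) 4, ρ.toGaloisRep.IsSemisimple ∧
      ∀ v, (∃ q : ℕ, q.Prime ∧ q ≠ p ∧ ((q : ℕ) : 𝓞 K) ∈ v.asIdeal ∧
          Algebra.IsUnramifiedIn (𝓞 K) (Ideal.span {(q : ℤ)}) ∧ π.1.IsUnramifiedAbove q) →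
        ∀ α : Multiset ℂ, π.1.HasSatakeParamAt v α →
          ρ.IsUnramifiedAt v ∧
            ρ.HasFrobCharpolyAt v (arithFrobPolyOfSatake ι v.residueCard 2 α *
              ((B v).map fun b ↦
                X - C (b * ((v.residueCard : PadicAlgCl p)⁻¹) ^ (2 * N))).prod) := by
    intro N hNN
    obtain ⟨E, S, P, hEfin, hSfin, hgoodS, hsat, hPgood, hPE, happrox⟩ := hN N hNN
    haveI := hEfin
    -- Cor. 6.26 applied to `π‖det‖^N`: the algebra-valued limit theorem in rank `4`, fed with the
    -- Galois representations (β′) attached to the cuspidal approximants of (α)₂'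
    obtain ⟨ρ', hss', hρ'⟩ : ∃ ρ' : FramedGaloisRep K (PadicAlgCl p) 4,
        ρ'.toGaloisRep.IsSemisimple ∧
        ∀ v ∉ S, ((p : ℕ) : 𝓞 K) ∉ v.asIdeal → ρ'.IsUnramifiedAt v ∧ ρ'.HasFrobCharpolyAt v (P v) := by
      refine exists_semisimple_galoisRep_of_algebraValuedLimit K 4 p E hEfin S hSfin P hPE fun m ↦ ?_
      obtain ⟨r, hcpt4, σ', Q, δ, hδ, hinf, hunr, htrans⟩ := happrox m
      choose ρ'' hρ''ss hρ'' using fun i ↦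
        hβ Fp K cK hFp h2 hc hK 2 p ι E₀ hE₀ hsplit hcpt4 (σ' i) (hinf i)
      refine ⟨r, ρ'', Q, δ, hδ, fun i v hvS hpv ↦ ?_, htrans⟩
      obtain ⟨-, ⟨β, hβv⟩, hQ⟩ := hunr i v hvS hpv
      -- every place over the rational prime below `v` is prime to `p`, hence outside `S`
      -- (saturation of `S`), hence unramified over `ℚ` with `σ' i` unramified there
      have hall : ∀ u' : HeightOneSpectrum (𝓞 K), u'.asIdeal.under ℤ = v.asIdeal.under ℤ →
          u'.asIdeal.ramificationIdx ℤ = 1 ∧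
            UnitaryGroup.IsUnramifiedAt Fp K cK (2 * 2) hcpt4 (σ' i).1 u' := by
        intro u' hu'
        have hpu' : ((p : ℕ) : 𝓞 K) ∉ u'.asIdeal := fun h ↦
          hpv ((natCast_mem_iff_mem_under v p).2 (hu' ▸ (natCast_mem_iff_mem_under u' p).1 h))
        have hu'S : u' ∉ S := fun hu'S ↦ hvS (hsat u' hu'S hpu' v hu'.symm)
        obtain ⟨he', hβ', -⟩ := hunr i u' hu'S hpu'
        exact ⟨he', hβ'⟩
      obtain ⟨hunrρ, hchar⟩ := hρ'' i v β hpv hall hβv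
      refine ⟨hunrρ, ?_⟩
      rw [hQ β hβv]
      exact hchar
    -- Cor. 6.27: the Tate twist `ρ = ρ' ⊗ ε_p^{-N}`
    obtain ⟨ρ, hss, hρ⟩ := exists_tateTwist_semisimple ρ' hss' (-(N : ℤ))
    refine ⟨ρ, hss, fun v hgood α hαv ↦ ?_⟩
    have hvS : v ∉ S := hgoodS v hgood
    have hPv := hPgood v hgood α hαv
    obtain ⟨q, hq, hqp, hqv, -, -⟩ := hgood
    have hpv : ((p : ℕ) : 𝓞 K) ∉ v.asIdeal := natCast_not_mem_of_natCast_mem hq Fact.out hqp hqv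
    obtain ⟨hunr', hchar'⟩ := hρ' v hvS hpv
    obtain ⟨hunr_imp, htwist⟩ := hρ v hpv
    refine ⟨hunr_imp hunr', ?_⟩
    -- notation: `qv = q_v`, `s = √q_v`, and the multiset `β'` of roots of `P v`
    set qv : ℕ := v.residueCard with hqv_def
    have hqv0 : qv ≠ 0 := by
      have := v.one_lt_residueCard
      omega
    set β' : Multiset (PadicAlgCl p) :=
      (α.map fun a ↦ ι.symm (((Real.sqrt qv : ℝ) : ℂ) ^ (2 - 1) * (a * ((qv : ℂ)⁻¹) ^ N))⁻¹) +
        (B v).map (· * ((qv : PadicAlgCl p)⁻¹) ^ N) with hβ'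
    -- `P v = ∏_{b ∈ β'} (X - b)`
    have hPnew : P v = (β'.map fun b ↦ X - C b).prod := by
      rw [hPv]
      simp only [hβ', Multiset.map_add, Multiset.prod_add, Multiset.map_map, Function.comp_def,
        arithFrobPolyOfSatake_eq_prod_map]
    -- the target polynomial is `∏_{b ∈ β'} (X - q_v^{-N} b)`
    have hPold : arithFrobPolyOfSatake ι qv 2 α *
        ((B v).map fun b ↦ X - C (b * ((qv : PadicAlgCl p)⁻¹) ^ (2 * N))).prod =
        (β'.map fun b ↦ X - C ((qv : PadicAlgCl p) ^ (-(N : ℤ)) * b)).prod := by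
      simp only [hβ', Multiset.map_add, Multiset.prod_add, Multiset.map_map, Function.comp_def,
        arithFrobPolyOfSatake_eq_prod_map, zpow_neg_mul_symm_inv_rescale ι hqv0,
        zpow_neg_mul_mul_inv_pow]
    rw [hPold]
    rw [hPnew] at hchar'
    exact htwist β' hchar'
  -- assemble `R` (any value below `N₀`)
  choose R hRss hR using key
  refine ⟨N₀, fun N ↦ if h : N₀ ≤ N then R N h else R N₀ le_rfl, B, fun N hN ↦ ?_, hB,
    fun v hgood α hαv N hN ↦ ?_⟩
  · simp only [dif_pos hN]
    exact hRss N hN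
  · simp only [dif_pos hN]
    exact hR N hN v hgood α hαv

end Summit.Langlands.Langlands.Theorems.GaloisRepGL2CMae

end
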